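import Summits.BirchSwinnertonDyer.Rank1Residual.X11b.JetchevChaPairs1
import HarnessLib

/-!
# BSD rank-≤1 residual cell, class X11b: `BSD(E,5)` from PUBLISHED theorems (Miller 2011 Thm. 5.4 in the
# Cha case, FLAGGED) + a two-engine Jetchev–Cha index certificate for the Tamagawa-obstructed RESISTANT
# pairs of X11 ∧ r = 1 ∧ ¬sst ∧ p ≥ 5 (part 5 of 5)

HONEST FRAMING (cell `b2b-bsdres-*`, verbatim): prove what is provable now; shrink each hard class
to its core with data; no claim beyond stated classes; COMBINATION classes deleted from PUBLISHED
theorems only, CONSTRUCTION-shaped remainder typed; this is not "finishing BSD". Class X11b stays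
CONSTRUCTION-SHAPED; everything here is PER PAIR; no lane verdict is changed; no named fact.

Unit `b2b-bsdres-x11c`, gen 4. After gen 3 (Cha route, 24 pairs with `5 ∤ ∏ c_q`), the unit's
RESISTANT list for the `p`-adic certificate route on X11 ∧ `r = 1` ∧ ¬sst ∧ `p ≥ 5`
(HOME/b2b-bsdres-x11c/RESISTANT.md §A′; `N < 5·10⁵`) consists of 40 pairs at `p = 5` with `ρ̄_{E,5}`
irreducible NOT surjective (`5S4`/`5Ns`), no (ram) witness, and `5 ∣ c_q` at one bad prime `q`
(36×: `q = 5` itself, split `I₅`/`I₁₀`; 5×: a split `I₅` prime `q ∈ {3, 7, 41, 47, 59}`), so that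
`5 ∣ [E(K) : ℤ y_K]` in every Heegner field (Gross–Zagier + BSD over `K`). The PRINTED lever is
Jetchev's Tamagawa sharpening in the form of Miller 2011 Thm. 5.4 under the hypotheses of Thm. 5.2
(Cha) — tree fact `Miller2011.thm54_cha_padicValNat_shaOrder_add_tamagawa_le` (x9 gen 7), FLAGS
`Miller11-Thm54-Cha-case` (printed proof = citation of Jetchev 2008, printed under (\*): `p ∤ N`,
`ρ̄` surjective) and `JET@p|N` (here `p = 5 ∥ N`; the lane's flag, bsdN/HYPOTHESES.md v2) — whose
class-X11b form is `X11b/JetchevChaRoute.lean`. Here, for each certified pair (by increasing conductor):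

* the theorem `bsdp_j<label>`: for `W =` Cremona's model (literal a-invariants; NO instance
  hypothesis — `Δ ≠ 0` and global minimality are decided in the kernel, the latter by
  `isGloballyMinimal_of_krausCriterion_bounded₂`, patterns F2a/F2c/F3 where Silverman's criterion
  fails), the published binders `hMJ`, `hGZK`, the Heegner datum (`K` imaginary quadratic with the
  Heegner hypothesis for the level `N` and `5 ∤ d_K`, `5² ∤ N`, a Heegner point `P` of infinite
  order), ONE prime `q ∣ N` with `ord₅ [E(K) : ℤ P] ≤ ord₅ c_q(E)` (`c_q` = local Tamagawa number of
  `W ⊗ ℚ_q` on its `ℤ_q`-minimal model), `r_an(E) ≤ 1` and `#Ш_an = s` with `ord₅ s = 0` give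
  Miller's `BSDp W 5`; multiplicative reduction at `5` (`5 ∣ Δ`, `5 ∤ c₄`) and irreducibility of
  `E[5]` (Frobenius witness `ℓ`, kernel point count of `JetchevChaPairsCards{1,2}.lean`,
  root-freeness mod `5`) are KERNEL facts (`decide`), through the generic
  `bsdp_of_ainvs_of_jetchevChaCertificate` (part 1, §1).

The numbers left as binders are exactly what two engines certify: `r_an = 1`, `#Ш_an = 1`, the
Tamagawa number `c_q` at the named `q` (engine A: Tate's algorithm, `tateY.py` = unit engine Y
verbatim; engine B: PARI `elllocalred`, job j079111), and the Heegner index in the named field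
`K = ℚ(√D)`: engine 1 (cypari2 = X9 gen 7 `jobD1b.py` verbatim; gen-3 jobs j077797/j077800; Miller
2011 Thm. 4.1 / Cor. 4.8 normalisation, `m = √(4ρ) ∈ ℤ`, `ord₅ m`), engine 2 (stdlib python = X9 gen 7
`eng2` verbatim; gen-3 jobs j077966–j077972, gen-4 job j079105), AGREE on `m`; `ord₅ [E(K) : ℤ y_K] =
ord₅ m` because `E(K)[5] = 0` (`E[5]` irreducible, `[K:ℚ] = 2`) and `m = 2I_K/e`, `e ∈ {1,2}`. Three
pairs of the 40 STAY resistant (`84960d1`, `296240ce1`, `304560by1`: two bad primes with `5 ∥ c_q`,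
`ord₅ m = 2` in every field; Jetchev's `max`-form gives only `ord₅ #Ш ≤ 2`, RESISTANT.md §A″).
Labels certified here (part 5): `353440p1`, `389205l1`, `392040bu1`, `471105v1`, `169920dc1`.

References: R. L. Miller, LMS JCM 14 (2011) Thm. 5.4, Thm. 5.2, Thm. 4.1, Cor. 4.8, Def. 1.1
[Miller2011LMS]; D. Jetchev, Compos. Math. 144 (2008) [Jetchev2008]; B. Cha, J. Number Theory 111
(2005) [Cha2005]; B. Mazur, Invent. Math. 44 (1978) Prop. 6.3 (1) [Mazur1978]; J. H. Silverman, *AEC*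
(2009) VII.1, VII.5 [SilvermanAEC2009]; A. Kraus, Acta Arith. 54 (1989) [Kraus1989]; Cremona's tables
[Cremona2006].
-/

set_option autoImplicit false

noncomputable section

open scoped Classical

open WeierstrassCurve Literature.NumberTheory.EllipticCurves
  Literature.NumberTheory.EllipticCurves.Rank1Residual
  Literature.NumberTheory.EllipticCurves.Rank1Residual.X11RankOneCertificates
  Literature.NumberTheory.EllipticCurves.Miller2011
  Summit.BirchSwinnertonDyer.BirchSwinnertonDyer.Rank1Residual.IntModel
  Summit.BirchSwinnertonDyer.BirchSwinnertonDyer.Rank1Residual.X11RankOne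

namespace Summit.BirchSwinnertonDyer.Rank1Residual.X11b

/-! ### §1. Pairs `353440p1`, `389205l1`, `392040bu1`, `471105v1`, `169920dc1` -/

/-- **`BSD(E,5)` for `353440p1`** (`N = 353440 = 2^5·5·47^2`; `ρ̄_{E,5}` image `5S4`, `split` multiplicative at `5`, additive at
`2`, `47`; Tamagawa numbers `c_2 = 2` (III), `c_5 = 5` (I5, split), `c_47 = 1` (II), `∏ c_q = 10`) from Miller 2011 Thm. 5.4 in the Cha case (FLAGS
`Miller11-Thm54-Cha-case`, `JET@p|N`) + GZK and the Jetchev–Cha index certificate. Kernel: `Δ ≠ 0`,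
global minimality (`isGloballyMinimal_of_krausCriterion_bounded₂`), `5 ∣ Δ ∧ 5 ∤ c₄`, `E[5]` irreducible
(`ℓ = 3`, `#Ẽ(𝔽_3) = 4`, `a_3 = 0`). Numbers (binders): `r_an ≤ 1`, `#Ш_an` a `5`-adic unit, and the
certificate `ord₅ [E(K) : ℤ y_K] ≤ ord₅ c_q` — intended instance `q = 5` (Kodaira `I5`, split, `c_5 = 5`,
`ord₅ = 1`; engine A = Tate's algorithm `tateY` (engine Y verbatim), engine B = PARI `elllocalred`, job
j079111) and `K = ℚ(√-31)`: `m = √(4ρ) = 20`, `ord₅ m = 1` (engine 1 cypari2 job j077800, `N_{E^D} = 339655840`;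
engine 2 stdlib job j077966: `m = 20`, AGREE). Per pair; lane books the verdict (literal tier or PUB, with the flags).
[cite: Miller2011LMS, Thm. 5.4 and Def. 1.1] [cite: Cremona2006, Table 1 (Cremona label 353440p1)] -/
theorem bsdp_j353440p1 (hMJ : thm54_cha_padicValNat_shaOrder_add_tamagawa_le)
    (hGZK : rank_eq_analyticRank_of_analyticRank_le_one)
    (W : WeierstrassCurve ℚ) (hW : W = ⟨0, 0, 0, -12737, -553284⟩)
    {N : ℕ} [NeZero N] {K : Type} [Field K] [NumberField K] (hK : IsImaginaryQuadratic K)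
    (hH : SatisfiesHeegnerHypothesis N K) {P : (W.baseChange K).toAffine.Point}
    (hP : IsHeegnerPoint N W K P) (hnt : ¬ IsOfFinAddOrder P)
    (hpD : ¬ (5 : ℤ) ∣ NumberField.discr K) (hpN : ¬ 5 ^ 2 ∣ N)
    (q : ℕ) [Fact q.Prime] (hqN : q ∣ N)
    (hI : padicValNat 5 (AddSubgroup.zmultiples P).index ≤
      padicValNat 5 ((W.baseChange ℚ_[q]).localTamagawaNumber ℤ_[q]))
    (hr : W.analyticRank ≤ 1) {s : ℚ} (hs : shaAn W = (s : ℂ)) (hv : padicValRat 5 s = 0) :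
    BSDp W 5 := by
  subst hW
  haveI := isElliptic_of_discOf_ne_zero 0 0 0 (-12737) (-553284) (by decide +kernel)
  haveI := isGloballyMinimal_of_krausCriterion_bounded₂ 0 0 0 (-12737) (-553284) (by decide +kernel) (by decide +kernel)
    (by decide +kernel)
  haveI : Fact (Nat.Prime 5) := ⟨by norm_num⟩
  haveI : Fact (Nat.Prime 3) := ⟨by norm_num⟩
  exact bsdp_of_ainvs_of_jetchevChaCertificate hMJ hGZK 0 0 0 (-12737) (-553284)
    (integralModelInt_eq_of_map_eq _ (map_mk_int _ _ _ _ _)) 5 3 4 (by decide) (by decide +kernel)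
    (by decide +kernel) (by decide) (by decide +kernel) card_j353440p1_3 (by decide +kernel) hK hH hP hnt
    (mod_cast hpD) hpN q hqN hI hr hs hv

/-- **`BSD(E,5)` for `389205l1`** (`N = 389205 = 3^4·5·31^2`; `ρ̄_{E,5}` image `5S4`, `split` multiplicative at `5`, additive at
`3`, `31`; Tamagawa numbers `c_3 = 3` (IV), `c_5 = 5` (I5, split), `c_31 = 1` (II), `∏ c_q = 15`) from Miller 2011 Thm. 5.4 in the Cha case (FLAGS
`Miller11-Thm54-Cha-case`, `JET@p|N`) + GZK and the Jetchev–Cha index certificate. Kernel: `Δ ≠ 0`,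
global minimality (`isGloballyMinimal_of_krausCriterion_bounded₂`), `5 ∣ Δ ∧ 5 ∤ c₄`, `E[5]` irreducible
(`ℓ = 7`, `#Ẽ(𝔽_7) = 8`, `a_7 = 0`). Numbers (binders): `r_an ≤ 1`, `#Ш_an` a `5`-adic unit, and the
certificate `ord₅ [E(K) : ℤ y_K] ≤ ord₅ c_q` — intended instance `q = 5` (Kodaira `I5`, split, `c_5 = 5`,
`ord₅ = 1`; engine A = Tate's algorithm `tateY` (engine Y verbatim), engine B = PARI `elllocalred`, job
j079111) and `K = ℚ(√-104)`: `m = √(4ρ) = 60`, `ord₅ m = 1` (engine 1 cypari2 job j077797, `N_{E^D} = 4209641280`;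
engine 2 stdlib job j077967: `m = 60`, AGREE). Per pair; lane books the verdict (literal tier or PUB, with the flags).
[cite: Miller2011LMS, Thm. 5.4 and Def. 1.1] [cite: Cremona2006, Table 1 (Cremona label 389205l1)] -/
theorem bsdp_j389205l1 (hMJ : thm54_cha_padicValNat_shaOrder_add_tamagawa_le)
    (hGZK : rank_eq_analyticRank_of_analyticRank_le_one)
    (W : WeierstrassCurve ℚ) (hW : W = ⟨0, 0, 1, -2232, -40525⟩)
    {N : ℕ} [NeZero N] {K : Type} [Field K] [NumberField K] (hK : IsImaginaryQuadratic K)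
    (hH : SatisfiesHeegnerHypothesis N K) {P : (W.baseChange K).toAffine.Point}
    (hP : IsHeegnerPoint N W K P) (hnt : ¬ IsOfFinAddOrder P)
    (hpD : ¬ (5 : ℤ) ∣ NumberField.discr K) (hpN : ¬ 5 ^ 2 ∣ N)
    (q : ℕ) [Fact q.Prime] (hqN : q ∣ N)
    (hI : padicValNat 5 (AddSubgroup.zmultiples P).index ≤
      padicValNat 5 ((W.baseChange ℚ_[q]).localTamagawaNumber ℤ_[q]))
    (hr : W.analyticRank ≤ 1) {s : ℚ} (hs : shaAn W = (s : ℂ)) (hv : padicValRat 5 s = 0) :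
    BSDp W 5 := by
  subst hW
  haveI := isElliptic_of_discOf_ne_zero 0 0 1 (-2232) (-40525) (by decide +kernel)
  haveI := isGloballyMinimal_of_krausCriterion_bounded₂ 0 0 1 (-2232) (-40525) (by decide +kernel) (by decide +kernel)
    (by decide +kernel)
  haveI : Fact (Nat.Prime 5) := ⟨by norm_num⟩
  haveI : Fact (Nat.Prime 7) := ⟨by norm_num⟩
  exact bsdp_of_ainvs_of_jetchevChaCertificate hMJ hGZK 0 0 1 (-2232) (-40525)
    (integralModelInt_eq_of_map_eq _ (map_mk_int _ _ _ _ _)) 5 7 8 (by decide) (by decide +kernel)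
    (by decide +kernel) (by decide) (by decide +kernel) card_j389205l1_7 (by decide +kernel) hK hH hP hnt
    (mod_cast hpD) hpN q hqN hI hr hs hv

/-- **`BSD(E,5)` for `392040bu1`** (`N = 392040 = 2^3·3^4·5·11^2`; `ρ̄_{E,5}` image `5S4`, `split` multiplicative at `5`, additive at
`2`, `3`, `11`; Tamagawa numbers `c_2 = 4` (I1*), `c_3 = 3` (IV*), `c_5 = 5` (I5, split), `c_11 = 1` (I0*), `∏ c_q = 60`) from Miller 2011 Thm. 5.4 in the Cha case (FLAGS
`Miller11-Thm54-Cha-case`, `JET@p|N`) + GZK and the Jetchev–Cha index certificate. Kernel: `Δ ≠ 0`,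
global minimality (`isGloballyMinimal_of_krausCriterion_bounded₂`), `5 ∣ Δ ∧ 5 ∤ c₄`, `E[5]` irreducible
(`ℓ = 7`, `#Ẽ(𝔽_7) = 8`, `a_7 = 0`). Numbers (binders): `r_an ≤ 1`, `#Ш_an` a `5`-adic unit, and the
certificate `ord₅ [E(K) : ℤ y_K] ≤ ord₅ c_q` — intended instance `q = 5` (Kodaira `I5`, split, `c_5 = 5`,
`ord₅ = 1`; engine A = Tate's algorithm `tateY` (engine Y verbatim), engine B = PARI `elllocalred`, job
j079111) and `K = ℚ(√-359)`: `m = √(4ρ) = 120`, `ord₅ m = 1` (engine 1 cypari2 job j077800, `N_{E^D} = 50526507240`;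
engine 2 stdlib job j077968: `m = 120`, AGREE). Per pair; lane books the verdict (literal tier or PUB, with the flags).
[cite: Miller2011LMS, Thm. 5.4 and Def. 1.1] [cite: Cremona2006, Table 1 (Cremona label 392040bu1)] -/
theorem bsdp_j392040bu1 (hMJ : thm54_cha_padicValNat_shaOrder_add_tamagawa_le)
    (hGZK : rank_eq_analyticRank_of_analyticRank_le_one)
    (W : WeierstrassCurve ℚ) (hW : W = ⟨0, 0, 0, -1032372, -403500636⟩)
    {N : ℕ} [NeZero N] {K : Type} [Field K] [NumberField K] (hK : IsImaginaryQuadratic K)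
    (hH : SatisfiesHeegnerHypothesis N K) {P : (W.baseChange K).toAffine.Point}
    (hP : IsHeegnerPoint N W K P) (hnt : ¬ IsOfFinAddOrder P)
    (hpD : ¬ (5 : ℤ) ∣ NumberField.discr K) (hpN : ¬ 5 ^ 2 ∣ N)
    (q : ℕ) [Fact q.Prime] (hqN : q ∣ N)
    (hI : padicValNat 5 (AddSubgroup.zmultiples P).index ≤
      padicValNat 5 ((W.baseChange ℚ_[q]).localTamagawaNumber ℤ_[q]))
    (hr : W.analyticRank ≤ 1) {s : ℚ} (hs : shaAn W = (s : ℂ)) (hv : padicValRat 5 s = 0) :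
    BSDp W 5 := by
  subst hW
  haveI := isElliptic_of_discOf_ne_zero 0 0 0 (-1032372) (-403500636) (by decide +kernel)
  haveI := isGloballyMinimal_of_krausCriterion_bounded₂ 0 0 0 (-1032372) (-403500636) (by decide +kernel) (by decide +kernel)
    (by decide +kernel)
  haveI : Fact (Nat.Prime 5) := ⟨by norm_num⟩
  haveI : Fact (Nat.Prime 7) := ⟨by norm_num⟩
  exact bsdp_of_ainvs_of_jetchevChaCertificate hMJ hGZK 0 0 0 (-1032372) (-403500636)
    (integralModelInt_eq_of_map_eq _ (map_mk_int _ _ _ _ _)) 5 7 8 (by decide) (by decide +kernel)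
    (by decide +kernel) (by decide) (by decide +kernel) card_j392040bu1_7 (by decide +kernel) hK hH hP hnt
    (mod_cast hpD) hpN q hqN hI hr hs hv

/-- **`BSD(E,5)` for `471105v1`** (`N = 471105 = 3^2·5·19^2·29`; `ρ̄_{E,5}` image `5Ns`, `split` multiplicative at `5`, additive at
`3`, `19`; Tamagawa numbers `c_3 = 2` (I0*), `c_5 = 5` (I5, split), `c_19 = 2` (III*), `c_29 = 1` (I5, nonsplit), `∏ c_q = 20`) from Miller 2011 Thm. 5.4 in the Cha case (FLAGS
`Miller11-Thm54-Cha-case`, `JET@p|N`) + GZK and the Jetchev–Cha index certificate. Kernel: `Δ ≠ 0`,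
global minimality (`isGloballyMinimal_of_krausCriterion_bounded₂`), `5 ∣ Δ ∧ 5 ∤ c₄`, `E[5]` irreducible
(`ℓ = 13`, `#Ẽ(𝔽_13) = 19`, `a_13 = -5`). Numbers (binders): `r_an ≤ 1`, `#Ш_an` a `5`-adic unit, and the
certificate `ord₅ [E(K) : ℤ y_K] ≤ ord₅ c_q` — intended instance `q = 5` (Kodaira `I5`, split, `c_5 = 5`,
`ord₅ = 1`; engine A = Tate's algorithm `tateY` (engine Y verbatim), engine B = PARI `elllocalred`, job
j079111) and `K = ℚ(√-59)`: `m = √(4ρ) = 80`, `ord₅ m = 1` (engine 1 cypari2 job j077797, `N_{E^D} = 1639916505`;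
engine 2 stdlib job j077971: `m = 80`, AGREE). Per pair; lane books the verdict (literal tier or PUB, with the flags).
[cite: Miller2011LMS, Thm. 5.4 and Def. 1.1] [cite: Cremona2006, Table 1 (Cremona label 471105v1)] -/
theorem bsdp_j471105v1 (hMJ : thm54_cha_padicValNat_shaOrder_add_tamagawa_le)
    (hGZK : rank_eq_analyticRank_of_analyticRank_le_one)
    (W : WeierstrassCurve ℚ) (hW : W = ⟨0, 0, 1, -96423822, -409535013130⟩)
    {N : ℕ} [NeZero N] {K : Type} [Field K] [NumberField K] (hK : IsImaginaryQuadratic K)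
    (hH : SatisfiesHeegnerHypothesis N K) {P : (W.baseChange K).toAffine.Point}
    (hP : IsHeegnerPoint N W K P) (hnt : ¬ IsOfFinAddOrder P)
    (hpD : ¬ (5 : ℤ) ∣ NumberField.discr K) (hpN : ¬ 5 ^ 2 ∣ N)
    (q : ℕ) [Fact q.Prime] (hqN : q ∣ N)
    (hI : padicValNat 5 (AddSubgroup.zmultiples P).index ≤
      padicValNat 5 ((W.baseChange ℚ_[q]).localTamagawaNumber ℤ_[q]))
    (hr : W.analyticRank ≤ 1) {s : ℚ} (hs : shaAn W = (s : ℂ)) (hv : padicValRat 5 s = 0) :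
    BSDp W 5 := by
  subst hW
  haveI := isElliptic_of_discOf_ne_zero 0 0 1 (-96423822) (-409535013130) (by decide +kernel)
  haveI := isGloballyMinimal_of_krausCriterion_bounded₂ 0 0 1 (-96423822) (-409535013130) (by decide +kernel) (by decide +kernel)
    (by decide +kernel)
  haveI : Fact (Nat.Prime 5) := ⟨by norm_num⟩
  haveI : Fact (Nat.Prime 13) := ⟨by norm_num⟩
  exact bsdp_of_ainvs_of_jetchevChaCertificate hMJ hGZK 0 0 1 (-96423822) (-409535013130)
    (integralModelInt_eq_of_map_eq _ (map_mk_int _ _ _ _ _)) 5 13 19 (by decide) (by decide +kernel)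
    (by decide +kernel) (by decide) (by decide +kernel) card_j471105v1_13 (by decide +kernel) hK hH hP hnt
    (mod_cast hpD) hpN q hqN hI hr hs hv

/-- **`BSD(E,5)` for `169920dc1`** (`N = 169920 = 2^6·3^2·5·59`; `ρ̄_{E,5}` image `5Ns`, `nonsplit` multiplicative at `5`, additive at
`2`, `3`; Tamagawa numbers `c_2 = 1` (II), `c_3 = 2` (III*), `c_5 = 1` (I5, nonsplit), `c_59 = 5` (I5, split), `∏ c_q = 10`) from Miller 2011 Thm. 5.4 in the Cha case (FLAGS
`Miller11-Thm54-Cha-case`, `JET@p|N`) + GZK and the Jetchev–Cha index certificate. Kernel: `Δ ≠ 0`,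
global minimality (`isGloballyMinimal_of_krausCriterion_bounded₂`), `5 ∣ Δ ∧ 5 ∤ c₄`, `E[5]` irreducible
(`ℓ = 7`, `#Ẽ(𝔽_7) = 8`, `a_7 = 0`). Numbers (binders): `r_an ≤ 1`, `#Ш_an` a `5`-adic unit, and the
certificate `ord₅ [E(K) : ℤ y_K] ≤ ord₅ c_q` — intended instance `q = 59` (Kodaira `I5`, split, `c_59 = 5`,
`ord₅ = 1`; engine A = Tate's algorithm `tateY` (engine Y verbatim), engine B = PARI `elllocalred`, job
j079111) and `K = ℚ(√-431)`: `m = √(4ρ) = 60`, `ord₅ m = 1` (engine 1 cypari2 job j077797, `N_{E^D} = 31564509120`;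
engine 2 stdlib job j079105 (gen 4): `m = 60`, AGREE). Per pair; lane books the verdict (literal tier or PUB, with the flags).
[cite: Miller2011LMS, Thm. 5.4 and Def. 1.1] [cite: Cremona2006, Table 1 (Cremona label 169920dc1)] -/
theorem bsdp_j169920dc1 (hMJ : thm54_cha_padicValNat_shaOrder_add_tamagawa_le)
    (hGZK : rank_eq_analyticRank_of_analyticRank_le_one)
    (W : WeierstrassCurve ℚ) (hW : W = ⟨0, 0, 0, -445878, 81349002⟩)
    {N : ℕ} [NeZero N] {K : Type} [Field K] [NumberField K] (hK : IsImaginaryQuadratic K)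
    (hH : SatisfiesHeegnerHypothesis N K) {P : (W.baseChange K).toAffine.Point}
    (hP : IsHeegnerPoint N W K P) (hnt : ¬ IsOfFinAddOrder P)
    (hpD : ¬ (5 : ℤ) ∣ NumberField.discr K) (hpN : ¬ 5 ^ 2 ∣ N)
    (q : ℕ) [Fact q.Prime] (hqN : q ∣ N)
    (hI : padicValNat 5 (AddSubgroup.zmultiples P).index ≤
      padicValNat 5 ((W.baseChange ℚ_[q]).localTamagawaNumber ℤ_[q]))
    (hr : W.analyticRank ≤ 1) {s : ℚ} (hs : shaAn W = (s : ℂ)) (hv : padicValRat 5 s = 0) :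
    BSDp W 5 := by
  subst hW
  haveI := isElliptic_of_discOf_ne_zero 0 0 0 (-445878) 81349002 (by decide +kernel)
  haveI := isGloballyMinimal_of_krausCriterion_bounded₂ 0 0 0 (-445878) 81349002 (by decide +kernel) (by decide +kernel)
    (by decide +kernel)
  haveI : Fact (Nat.Prime 5) := ⟨by norm_num⟩
  haveI : Fact (Nat.Prime 7) := ⟨by norm_num⟩
  exact bsdp_of_ainvs_of_jetchevChaCertificate hMJ hGZK 0 0 0 (-445878) 81349002
    (integralModelInt_eq_of_map_eq _ (map_mk_int _ _ _ _ _)) 5 7 8 (by decide) (by decide +kernel)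
    (by decide +kernel) (by decide) (by decide +kernel) card_j169920dc1_7 (by decide +kernel) hK hH hP hnt
    (mod_cast hpD) hpN q hqN hI hr hs hv

end Summit.BirchSwinnertonDyer.Rank1Residual.X11b

end
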